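import Summits.QuantumFields.YangMills.Theorems.SwapVirialDeficitSectorLaplaceTipApexRef
import Summits.QuantumFields.YangMills.Theorems.SwapVirialDeficitSectorLaplaceTipShellDischarge
import Summits.QuantumFields.YangMills.Theorems.SwapVirialDeficitBlowUpGnomonicLeaderGroupDistApex
import Summits.QuantumFields.YangMills.Theorems.SwapVirialDeficitBlowUpGnomonicEulerJacobian
import HarnessLib

/-!
# Route `SwapVirialDeficit` (YangMills): THE CORE CEILING OF THE TIP (hCore) FROM A LEADER LAYER — the frame-independent assembly S4
# (cell ym-idea-1, skeleton ➎, `stub_core_tip`, the core; free-hands support of ⟨stmt-QuantumFields-24197⟩ `SwapVirialDeficit.SwapGluedStiffness`)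

g49's FROZEN binder (STATUS 01:31Z, consumed by ✓`tipCore_le_mbMain_of_profile`):
`hubIntegral_hubAt_core_ceiling : ∃ Φ>0 cΦ CT pT QT>0 K₁>0 k₁ DR≥1 dR, ∀ L b (K₁L^k₁ ≤ b) ε (good) δs δt (DR·L^dR ≤ δs ≤ δt),
  I(hubAt δt 1, ε; b) ≤ Φ·L^cΦ·((2π∕b)^α·∫_p Profile(δt,p)·𝔪(hubAt δs 1, ε, p)) + e^{CT·L^pT − b∕(QT·L^pT)}`, `Profile = (1+δt²)²∕(1+h(p)(1+δt²))`.
This file proves it FROM A LEADER LAYER — the one remaining frame-specific estimate (caps frame (B5): w3 g68 + LEAD g100; aligned frame: w2 g61), stated as the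
explicit ∃-constants hypothesis `hLL` of
★★★ `hubIntegral_hubAt_core_ceiling_of_leaderLayer (hLL) : <the frozen binder, verbatim>`:
`hLL` ≔ for every follower-Hessian family `A₀` at the apex hub `1` (symmetric, `yy`, `ray`, `ambient` readings — ✓`exists_gnoFolHessian`),
`∫⁻_{(x,y)}∫⁻_z w(x)w(y)w(z)·∫⁻_F e^{−bF̂(hubAt δt 1, ε, ((x,y),(z,F)))}·piWeight F ≤ ofReal(Φ·L^cΦ·(2π∕b)^{7∕2}·G_b)·∫⁻_p Profile(δt,p)·(1+p₁²)⁻¹(1+p₂²)⁻¹∕√det A₀(gnoBase p) + ofReal(e^{CT·L^pT − b∕(QT·L^pT)})`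
(`G_b = (2π∕((1−1∕(2d))b))^{d∕2}` the follower Gaussian of ✓`tip_follower_ceiling_mod_rot_group`, `w = gnomonicWeight`), for `b ≥ K₁L^k₁`, `δt ≥ DR·L^dR`.
The assembly: Tonelli on `GnoCoord L = leaders × (z × F)` (`gnoDensity = w(x)w(y)w(z)·piWeight`), ✓`apexRef_le_mbDensity_hubAt` at `δr := δs`
(`(1+p₁²)⁻¹(1+p₂²)⁻¹∕√det A₀(gnoBase p) ≤ e·C_L·𝔪(hubAt δs 1, ε, p)`, `C_L = ((1+d)·20400L⁴)^{7∕2} ≤ (19·20400)^{7∕2}·L²⁸`), ✓`integrable_mbDensity_hubAt_of_window`,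
Bernoulli `(1−1∕(2d))^{d∕2} ≥ 3∕4` (`G_b ≤ (4∕3)(2π∕b)^{d∕2}`) and `(2π∕b)^{7∕2}·(2π∕b)^{d∕2} = (2π∕b)^α` (✓`two_alpha_eq`: `7 + d = 2α`).

HONEST LABEL: the assembly is PROVED here; the leader layer `hLL` is NOT (it is the open S3 of either frame), so hCore, `stub_core_tip`, ⟨24197⟩ ∕ ⟨24194⟩ remain OPEN;
own crux ⟨22884⟩ `LargeFieldMassRefinementTail` OPEN (blocked-on ⟨19935⟩); the Yang–Mills mass gap is NOT proved; no summit is proved by a line.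
THEOREMS ONLY (0 `def`, 0 `sorry`, no instance), standard axioms.  Width seat ym-line-sfw-p2-w2 g61 (cell ym-idea-1, free hands), `--supports stmt-QuantumFields-24197`.
References: [cite: Luscher1983, §2]; [folklore].
-/

set_option autoImplicit false
set_option synthInstance.maxSize 1024

noncomputable section

open MeasureTheory Quaternion Set Module
open scoped Quaternion BigOperators ENNReal InnerProductSpace
open Literature.MathematicalPhysics.QuantumLattice
open Literature.MathematicalPhysics.QuantumFieldTheory hiding SU2

namespace Summit.QuantumFields.YangMills.Theorems.SwapVirialDeficit.SectorLaplace

open Summit.QuantumFields.YangMills.Theorems.FemtoTransferGap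
open Summit.QuantumFields.YangMills.Theorems.FemtoTransferGap.TT
open Summit.QuantumFields.YangMills.Theorems.VirialFluxGap.RingDeficit
open Summit.QuantumFields.YangMills.Theorems.SwapVirialDeficit.SwapRing
open Summit.QuantumFields.YangMills.Theorems.SwapVirialDeficit.BlowUpRing
open Summit.QuantumFields.YangMills.Theorems.SwapVirialDeficit.Gnomonic (piWeight piWeight_pos piWeight_le_one gnomonicWeight gnomonicWeight_pos normSq3)

/-! ## §1 Small real-analysis helpers -/

/-- Bernoulli: `(4∕3)⁻¹ ≤ (1 − 1∕(2d))^{d∕2}` for `d ≥ 2`, hence `G_b ≤ (4∕3)·(2π∕b)^{d∕2}`. [folklore] -/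
theorem followerGauss_le {d b : ℝ} (hd : 2 ≤ d) (hb : 0 < b) :
    (2 * Real.pi / ((1 - 1 / (2 * d)) * b)) ^ (d / 2) ≤ 4 / 3 * (2 * Real.pi / b) ^ (d / 2) := by
  have hd0 : 0 < d := by linarith
  have hc0 : 0 < 1 - 1 / (2 * d) := by
    rw [sub_pos, div_lt_one (by positivity)]; linarith
  have hbern : 3 / 4 ≤ (1 - 1 / (2 * d)) ^ (d / 2) := by
    have h := one_add_mul_self_le_rpow_one_add (s := -(1 / (2 * d))) (p := d / 2) (by
      rw [neg_le, neg_neg, div_le_one (by positivity)]; linarith) (by linarith)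
    have e1 : 1 + d / 2 * -(1 / (2 * d)) = 3 / 4 := by field_simp; ring
    have e2 : (1 : ℝ) + -(1 / (2 * d)) = 1 - 1 / (2 * d) := by ring
    rw [e1, e2] at h
    exact h
  have hsplit : 2 * Real.pi / ((1 - 1 / (2 * d)) * b) = (2 * Real.pi / b) * (1 - 1 / (2 * d))⁻¹ := by
    field_simp
  rw [hsplit, Real.mul_rpow (by positivity) (by positivity), Real.inv_rpow hc0.le, mul_comm]
  refine mul_le_mul_of_nonneg_right ?_ (by positivity)
  rw [inv_le_comm₀ (by positivity) (by norm_num)]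
  norm_num at hbern ⊢
  exact hbern

/-- `((1+d)·20400L⁴)^{7∕2} ≤ (19·20400)^{7∕2}·L²⁸` for `d ≤ 18L⁴`, `L ≥ 1`. [folklore] -/
theorem leaderCeilConst_le {d Lr : ℝ} (hL : 1 ≤ Lr) (hd0 : 0 ≤ d) (hd : d ≤ 18 * Lr ^ 4) :
    ((1 + d) * (20400 * Lr ^ 4)) ^ ((7 : ℝ) / 2) ≤ (19 * 20400 : ℝ) ^ ((7 : ℝ) / 2) * Lr ^ 28 := by
  have hL0 : 0 < Lr := by linarith
  have hL4 : 1 ≤ Lr ^ 4 := one_le_pow₀ hL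
  have hle : (1 + d) * (20400 * Lr ^ 4) ≤ 19 * 20400 * Lr ^ 8 := by nlinarith
  calc ((1 + d) * (20400 * Lr ^ 4)) ^ ((7 : ℝ) / 2) ≤ (19 * 20400 * Lr ^ 8) ^ ((7 : ℝ) / 2) :=
        Real.rpow_le_rpow (by positivity) hle (by norm_num)
    _ = (19 * 20400 : ℝ) ^ ((7 : ℝ) / 2) * (Lr ^ 8) ^ ((7 : ℝ) / 2) := by rw [Real.mul_rpow (by norm_num) (by positivity)]
    _ = (19 * 20400 : ℝ) ^ ((7 : ℝ) / 2) * Lr ^ 28 := by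
        congr 1
        rw [← Real.rpow_natCast Lr 8, ← Real.rpow_mul hL0.le, ← Real.rpow_natCast Lr 28]
        norm_num

variable {L : ℕ} [NeZero L]

/-- `7 + d = 2α`: `(finrank V_F : ℝ) + 7 = finrank V_L` (✓`two_alpha_eq`, ✓`finrank_gnoFibre`, ✓`finrank_gnoFol_real`). [folklore] -/
theorem seven_add_finrank_gnoFol : (7 : ℝ) / 2 + (finrank ℝ (GnoFol L) : ℝ) / 2 = alpha L := by
  rw [alpha, finrank_gnoFibre, ← two_alpha_eq, finrank_gnoFol_real]
  push_cast
  ring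

/-- The hub integral's integrand is measurable in `ℝ≥0∞` form. [folklore] -/
theorem measurable_hubIntegrand (δ : ℝ) (ε : GnoSign L) (b : ℝ) :
    Measurable fun η : GnoCoord L => ENNReal.ofReal (Real.exp (-(b * gnoDeficit z₀ (fun _ => 1) (hubAt δ 1) ε η)) * gnoDensity η) := by
  have hc : Continuous fun η : GnoCoord L => gnoDeficit z₀ (fun _ => 1) (hubAt δ 1) ε η :=
    (Gnomonic.contDiff_gnoDeficit (n := 0) (fun _ => false) (fun _ => (1 : SU2)) (hubAt_one_ne_zero δ) ε).continuous
  exact ENNReal.measurable_ofReal.comp ((Real.continuous_exp.comp (hc.const_mul b).neg).mul continuous_gnoDensity).measurable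

/-- ★ TONELLI ON `GnoCoord L = leaders × (z × followers)`: the hub integral's `ℝ≥0∞` form is the leader-layer iterated integral. [folklore] -/
theorem lintegral_hub_eq_leaderLayer (δ : ℝ) (ε : GnoSign L) (b : ℝ) :
    ∫⁻ η : GnoCoord L, ENNReal.ofReal (Real.exp (-(b * gnoDeficit z₀ (fun _ => 1) (hubAt δ 1) ε η)) * gnoDensity η) =
      ∫⁻ xy : (Fin 3 → ℝ) × (Fin 3 → ℝ), ∫⁻ z : Fin 3 → ℝ, ENNReal.ofReal (gnomonicWeight xy.1 * gnomonicWeight xy.2 * gnomonicWeight z) *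
        ∫⁻ F : Fol L → Fin 3 → ℝ, ENNReal.ofReal (Real.exp (-(b * gnoDeficit (fun _ => false) (fun _ => 1) (hubAt δ 1) ε ((xy, (z, F)) : GnoCoord L))) * piWeight F) := by
  have hm := measurable_hubIntegrand (L := L) δ ε b
  rw [Measure.volume_eq_prod, lintegral_prod _ hm.aemeasurable]
  refine lintegral_congr fun xy => ?_
  have hm2 : Measurable fun zF : (Fin 3 → ℝ) × (Fol L → Fin 3 → ℝ) =>
      ENNReal.ofReal (Real.exp (-(b * gnoDeficit z₀ (fun _ => 1) (hubAt δ 1) ε ((xy, zF) : GnoCoord L))) * gnoDensity ((xy, zF) : GnoCoord L)) :=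
    hm.comp measurable_prodMk_left
  rw [Measure.volume_eq_prod, lintegral_prod _ hm2.aemeasurable]
  refine lintegral_congr fun z => ?_
  have hm3 : Measurable fun F : Fol L → Fin 3 → ℝ =>
      ENNReal.ofReal (Real.exp (-(b * gnoDeficit (fun _ => false) (fun _ => 1) (hubAt δ 1) ε ((xy, (z, F)) : GnoCoord L))) * piWeight F) := by
    have hc : Continuous fun F : Fol L → Fin 3 → ℝ => gnoDeficit z₀ (fun _ => 1) (hubAt δ 1) ε ((xy, (z, F)) : GnoCoord L) :=
      (Gnomonic.contDiff_gnoDeficit (n := 0) (fun _ => false) (fun _ => (1 : SU2)) (hubAt_one_ne_zero δ) ε).continuous.comp (by fun_prop)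
    exact ENNReal.measurable_ofReal.comp ((Real.continuous_exp.comp (hc.const_mul b).neg).mul Gnomonic.continuous_piWeight).measurable
  rw [← lintegral_const_mul _ hm3]
  refine lintegral_congr fun F => ?_
  rw [← ENNReal.ofReal_mul (by
    exact mul_nonneg (mul_nonneg (gnomonicWeight_pos _).le (gnomonicWeight_pos _).le) (gnomonicWeight_pos _).le)]
  congr 1
  simp only [gnoDensity]
  ring

/-! ## §2 The assembly -/

set_option maxHeartbeats 1600000 in
/-- ★★★ **THE CORE CEILING OF THE TIP FROM A LEADER LAYER** — g49's frozen (hCore) binder, verbatim, from the leader-layer estimate `hLL`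
(see the file header). [cite: Luscher1983, §2] -/
theorem hubIntegral_hubAt_core_ceiling_of_leaderLayer
    (hLL : ∃ Φ : ℝ, 0 < Φ ∧ ∃ cΦ : ℕ, ∃ CT : ℝ, ∃ pT : ℕ, ∃ QT : ℝ, 0 < QT ∧ ∃ K₁ : ℝ, 0 < K₁ ∧ ∃ k₁ : ℕ, ∃ DR : ℝ, 1 ≤ DR ∧ ∃ dR : ℕ,
      ∀ (L : ℕ) [NeZero L] (b : ℝ), K₁ * (L : ℝ) ^ k₁ ≤ b → ∀ ε : GnoSign L, GoodSign ε → ∀ δt : ℝ, DR * (L : ℝ) ^ dR ≤ δt →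
        ∀ (A0 : GnoCoord L → GnoFol L →ₗ[ℝ] GnoFol L), (∀ η, (A0 η).IsSymmetric) →
          (∀ η (y : GnoFol L), ⟪A0 η y, y⟫_ℝ = iteratedFDeriv ℝ 2 (fun y' : GnoFol L => gnoDeficit z₀ (fun _ => 1) ((1 : ℝ) : ℍ) ε (η + gnoFolEmb y')) 0 (fun _ => y)) →
          (∀ η (y : GnoFol L), ⟪A0 η y, y⟫_ℝ = iteratedDeriv 2 (fun s : ℝ => gnoDeficit (fun _ => false) (fun _ => 1) ((1 : ℝ) : ℍ) ε (η + s • gnoFolEmb y)) 0) →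
          (∀ η (y : GnoFol L), ⟪A0 η y, y⟫_ℝ = iteratedFDeriv ℝ 2 (gnoDeficit z₀ (fun _ => 1) ((1 : ℝ) : ℍ) ε) η (fun _ => gnoFolEmb y)) →
          ∫⁻ xy : (Fin 3 → ℝ) × (Fin 3 → ℝ), ∫⁻ z : Fin 3 → ℝ, ENNReal.ofReal (gnomonicWeight xy.1 * gnomonicWeight xy.2 * gnomonicWeight z) *
              ∫⁻ F : Fol L → Fin 3 → ℝ,
                ENNReal.ofReal (Real.exp (-(b * gnoDeficit (fun _ => false) (fun _ => 1) (hubAt δt 1) ε ((xy, (z, F)) : GnoCoord L))) * piWeight F) ≤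
            ENNReal.ofReal (Φ * (L : ℝ) ^ cΦ * (2 * Real.pi / b) ^ ((7 : ℝ) / 2) *
                (2 * Real.pi / ((1 - 1 / (2 * (finrank ℝ (GnoFol L) : ℝ))) * b)) ^ ((finrank ℝ (GnoFol L) : ℝ) / 2)) *
              (∫⁻ p : ℝ × ℝ, ENNReal.ofReal ((1 + δt ^ 2) ^ 2 / (1 + (p.1 ^ 2 / (1 + p.1 ^ 2) + p.2 ^ 2 / (1 + p.2 ^ 2)) * (1 + δt ^ 2)) *
                ((1 + p.1 ^ 2)⁻¹ * (1 + p.2 ^ 2)⁻¹ / Real.sqrt (LinearMap.det (A0 (gnoBase p.1 p.2)))))) +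
            ENNReal.ofReal (Real.exp (CT * (L : ℝ) ^ pT - b / (QT * (L : ℝ) ^ pT)))) :
    ∃ Φ : ℝ, 0 < Φ ∧ ∃ cΦ : ℕ, ∃ CT : ℝ, ∃ pT : ℕ, ∃ QT : ℝ, 0 < QT ∧ ∃ K₁ : ℝ, 0 < K₁ ∧ ∃ k₁ : ℕ, ∃ DR : ℝ, 1 ≤ DR ∧ ∃ dR : ℕ,
      ∀ (L : ℕ) [NeZero L] (b : ℝ), K₁ * (L : ℝ) ^ k₁ ≤ b → ∀ ε : GnoSign L, GoodSign ε → ∀ δs δt : ℝ, DR * (L : ℝ) ^ dR ≤ δs → δs ≤ δt →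
        hubIntegral (hubAt δt 1) ε b ≤ Φ * (L : ℝ) ^ cΦ * ((2 * Real.pi / b) ^ alpha L *
            ∫ p : ℝ × ℝ, ((1 + δt ^ 2) ^ 2 / (1 + (p.1 ^ 2 / (1 + p.1 ^ 2) + p.2 ^ 2 / (1 + p.2 ^ 2)) * (1 + δt ^ 2))) * mbDensity (hubAt δs 1) ε p) +
          Real.exp (CT * (L : ℝ) ^ pT - b / (QT * (L : ℝ) ^ pT)) := by
  obtain ⟨Φ, hΦ, cΦ, CT, pT, QT, hQT, K₁, hK₁, k₁, DR, hDR, dR, hmain⟩ := hLL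
  -- the apex-window constant: `δs ≥ Aw·L¹⁸` puts `δr := δs` in the window of ✓`apexRef_le_mbDensity_hubAt`
  set Aw : ℝ := 122689728 * 13824 * 36 with hAw
  refine ⟨Φ * (4 / 3) * (Real.exp 1 * ((19 * 20400 : ℝ) ^ ((7 : ℝ) / 2))), by positivity, cΦ + 28, CT, pT, QT, hQT, K₁, hK₁, k₁, DR + Aw,
    by rw [hAw]; linarith, max dR 18, ?_⟩
  intro L _ b hb ε hε δs δt hδs hst
  have hL : (0 : ℝ) < (L : ℝ) := Nat.cast_pos.2 (Nat.pos_of_ne_zero (NeZero.ne L))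
  have hL1 : (1 : ℝ) ≤ (L : ℝ) := by exact_mod_cast NeZero.one_le
  have hb0 : 0 < b := lt_of_lt_of_le (by positivity) hb
  have hpowmax : ∀ n : ℕ, n ≤ max dR 18 → (L : ℝ) ^ n ≤ (L : ℝ) ^ max dR 18 := fun n hn => pow_le_pow_right₀ hL1 hn
  have hLmax1 : (1 : ℝ) ≤ (L : ℝ) ^ max dR 18 := one_le_pow₀ hL1
  have hAw0 : 0 ≤ Aw := by rw [hAw]; norm_num
  have hδs1 : 1 ≤ δs := by
    have : (1 : ℝ) ≤ (DR + Aw) * (L : ℝ) ^ max dR 18 := by nlinarith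
    linarith
  have hδs0 : 0 < δs := by linarith
  have hδsA : Aw * (L : ℝ) ^ 18 ≤ δs := by
    have h1 : Aw * (L : ℝ) ^ 18 ≤ Aw * (L : ℝ) ^ max dR 18 := mul_le_mul_of_nonneg_left (hpowmax 18 (le_max_right _ _)) hAw0
    have h2 : Aw * (L : ℝ) ^ max dR 18 ≤ (DR + Aw) * (L : ℝ) ^ max dR 18 := by nlinarith
    linarith
  have hδtD : DR * (L : ℝ) ^ dR ≤ δt := by
    have h1 : DR * (L : ℝ) ^ dR ≤ DR * (L : ℝ) ^ max dR 18 := mul_le_mul_of_nonneg_left (hpowmax dR (le_max_left _ _)) (by linarith)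
    have h2 : DR * (L : ℝ) ^ max dR 18 ≤ (DR + Aw) * (L : ℝ) ^ max dR 18 := by nlinarith
    linarith
  -- the follower Hessian family at the apex hub `1`
  have h1 : ((1 : ℝ) : ℍ) ≠ 0 := by rw [← hubAt_one_zero]; exact hubAt_one_zero_ne_zero
  obtain ⟨A0, hA0s, -, hA0yy, hA0ray, hA0amb, -, -⟩ := exists_gnoFolHessian z₀ (fun _ => (1 : SU2)) h1 ε
  have hLLi := hmain L b hb ε hε δt hδtD A0 hA0s hA0yy hA0ray hA0amb
  -- the apex reference at `δr := δs`
  set μ : ℝ := (2304 * (L : ℝ) ^ 6 * (Fintype.card (Fol L) : ℝ))⁻¹ with hμ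
  obtain ⟨hN0, hN6, -⟩ := card_fol_facts (L := L)
  have hwin : 122689728 * δs⁻¹ * (L : ℝ) ^ 4 ≤ μ / (2 * (3 * (Fintype.card (Fol L) : ℝ))) := by
    have hlhs : 122689728 * δs⁻¹ * (L : ℝ) ^ 4 ≤ 1 / (13824 * 36 * (L : ℝ) ^ 14) := by
      rw [show 122689728 * δs⁻¹ * (L : ℝ) ^ 4 = 122689728 * (L : ℝ) ^ 4 / δs by ring, div_le_div_iff₀ hδs0 (by positivity)]
      have e : 122689728 * (L : ℝ) ^ 4 * (13824 * 36 * (L : ℝ) ^ 14) = Aw * (L : ℝ) ^ 18 := by rw [hAw]; ring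
      linarith [hδsA]
    have hrhs : 1 / (13824 * 36 * (L : ℝ) ^ 14) ≤ μ / (2 * (3 * (Fintype.card (Fol L) : ℝ))) := by
      have e : μ / (2 * (3 * (Fintype.card (Fol L) : ℝ))) = 1 / (13824 * (L : ℝ) ^ 6 * (Fintype.card (Fol L) : ℝ) ^ 2) := by
        rw [hμ]; field_simp; ring
      rw [e]
      refine one_div_le_one_div_of_le (by positivity) ?_
      have hN2 : (Fintype.card (Fol L) : ℝ) ^ 2 ≤ 36 * (L : ℝ) ^ 8 := by nlinarith
      nlinarith [pow_pos hL 6]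
    exact hlhs.trans hrhs
  set d : ℝ := (finrank ℝ (GnoFol L) : ℝ) with hd
  have hd9 : (9 : ℝ) ≤ d := nine_le_finrank_gnoFol (L := L)
  have hd18 : d ≤ 18 * (L : ℝ) ^ 4 := by rw [hd, finrank_gnoFol_real]; linarith
  set CL : ℝ := ((1 + d) * (20400 * (L : ℝ) ^ 4)) ^ ((7 : ℝ) / 2) with hCL
  have hX0 : 0 < (1 + d) * (20400 * (L : ℝ) ^ 4) := by positivity
  have hCL0 : 0 < CL := Real.rpow_pos_of_pos hX0 _
  have hkey : ∀ p : ℝ × ℝ, (1 + p.1 ^ 2)⁻¹ * (1 + p.2 ^ 2)⁻¹ / Real.sqrt (LinearMap.det (A0 (gnoBase p.1 p.2))) ≤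
      Real.exp 1 * CL * mbDensity (L := L) (hubAt δs 1) ε p := by
    intro p
    have h := apexRef_le_mbDensity_hubAt hε hδs1 le_rfl hwin hA0s hA0ray hA0amb p
    rw [Real.rpow_neg hX0.le] at h
    have h𝔪 : 0 ≤ mbDensity (L := L) (hubAt δs 1) ε p := mbDensity_nonneg _ ε p
    by_cases hD : Real.sqrt (LinearMap.det (A0 (gnoBase p.1 p.2))) = 0
    · rw [hD, div_zero]; positivity
    have hee : Real.exp 1 = Real.exp (1 / 2) * Real.exp (1 / 2) := by rw [← Real.exp_add]; norm_num
    calc (1 + p.1 ^ 2)⁻¹ * (1 + p.2 ^ 2)⁻¹ / Real.sqrt (LinearMap.det (A0 (gnoBase p.1 p.2)))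
        = (1 + p.1 ^ 2)⁻¹ * (1 + p.2 ^ 2)⁻¹ * ((((1 + d) * (20400 * (L : ℝ) ^ 4)) ^ ((7 : ℝ) / 2))⁻¹ * Real.exp (-(1 / 2 : ℝ)) /
            Real.sqrt (LinearMap.det (A0 (gnoBase p.1 p.2)))) * (CL * Real.exp (1 / 2)) := by
          rw [Real.exp_neg, hCL]; field_simp
      _ ≤ Real.exp (1 / 2) * mbDensity (L := L) (hubAt δs 1) ε p * (CL * Real.exp (1 / 2)) := mul_le_mul_of_nonneg_right h (by positivity)
      _ = Real.exp 1 * CL * mbDensity (L := L) (hubAt δs 1) ε p := by rw [hee]; ring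
  -- the profile: nonnegative, bounded by `(1+δt²)²`, measurable
  have hh0 : ∀ p : ℝ × ℝ, 0 ≤ p.1 ^ 2 / (1 + p.1 ^ 2) + p.2 ^ 2 / (1 + p.2 ^ 2) := fun p => by positivity
  have hprof0 : ∀ p : ℝ × ℝ, 0 ≤ (1 + δt ^ 2) ^ 2 / (1 + (p.1 ^ 2 / (1 + p.1 ^ 2) + p.2 ^ 2 / (1 + p.2 ^ 2)) * (1 + δt ^ 2)) := fun p => by positivity
  have hprof_le : ∀ p : ℝ × ℝ, (1 + δt ^ 2) ^ 2 / (1 + (p.1 ^ 2 / (1 + p.1 ^ 2) + p.2 ^ 2 / (1 + p.2 ^ 2)) * (1 + δt ^ 2)) ≤ (1 + δt ^ 2) ^ 2 :=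
    fun p => div_le_self (by positivity) (by nlinarith [hh0 p, sq_nonneg δt])
  have hprof_m : Measurable fun p : ℝ × ℝ => (1 + δt ^ 2) ^ 2 / (1 + (p.1 ^ 2 / (1 + p.1 ^ 2) + p.2 ^ 2 / (1 + p.2 ^ 2)) * (1 + δt ^ 2)) := by
    fun_prop
  -- integrability of `Profile·𝔪` on the shell hub `δs`
  have hInt𝔪 : Integrable fun p : ℝ × ℝ => mbDensity (L := L) (hubAt δs 1) ε p := by
    refine integrable_mbDensity_hubAt_of_window hε (τ := (1 + δs ^ 2)⁻¹) (by positivity) (inv_le_one_of_one_le₀ (by nlinarith)) ⟨?_, le_rfl⟩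
    rw [inv_eq_one_div, div_le_div_iff₀ (by positivity) (by positivity)]
    nlinarith
  have hIntP : Integrable fun p : ℝ × ℝ =>
      (1 + δt ^ 2) ^ 2 / (1 + (p.1 ^ 2 / (1 + p.1 ^ 2) + p.2 ^ 2 / (1 + p.2 ^ 2)) * (1 + δt ^ 2)) * mbDensity (L := L) (hubAt δs 1) ε p :=
    hInt𝔪.bdd_mul hprof_m.aestronglyMeasurable (ae_of_all _ fun p => by
      rw [Real.norm_eq_abs, abs_of_nonneg (hprof0 p)]; exact hprof_le p)
  set X : ℝ := ∫ p : ℝ × ℝ, (1 + δt ^ 2) ^ 2 / (1 + (p.1 ^ 2 / (1 + p.1 ^ 2) + p.2 ^ 2 / (1 + p.2 ^ 2)) * (1 + δt ^ 2)) *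
    mbDensity (L := L) (hubAt δs 1) ε p with hX
  have hXnn : 0 ≤ X := integral_nonneg fun p => mul_nonneg (hprof0 p) (mbDensity_nonneg _ ε p)
  -- the reference integral against `Profile·𝔪`
  have hlin : ∫⁻ p : ℝ × ℝ, ENNReal.ofReal ((1 + δt ^ 2) ^ 2 / (1 + (p.1 ^ 2 / (1 + p.1 ^ 2) + p.2 ^ 2 / (1 + p.2 ^ 2)) * (1 + δt ^ 2)) *
        ((1 + p.1 ^ 2)⁻¹ * (1 + p.2 ^ 2)⁻¹ / Real.sqrt (LinearMap.det (A0 (gnoBase p.1 p.2))))) ≤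
      ENNReal.ofReal (Real.exp 1 * CL) * ENNReal.ofReal X := by
    calc ∫⁻ p : ℝ × ℝ, ENNReal.ofReal ((1 + δt ^ 2) ^ 2 / (1 + (p.1 ^ 2 / (1 + p.1 ^ 2) + p.2 ^ 2 / (1 + p.2 ^ 2)) * (1 + δt ^ 2)) *
          ((1 + p.1 ^ 2)⁻¹ * (1 + p.2 ^ 2)⁻¹ / Real.sqrt (LinearMap.det (A0 (gnoBase p.1 p.2)))))
        ≤ ∫⁻ p : ℝ × ℝ, ENNReal.ofReal (Real.exp 1 * CL) * ENNReal.ofReal ((1 + δt ^ 2) ^ 2 / (1 + (p.1 ^ 2 / (1 + p.1 ^ 2) + p.2 ^ 2 / (1 + p.2 ^ 2)) * (1 + δt ^ 2)) *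
            mbDensity (L := L) (hubAt δs 1) ε p) := by
          refine lintegral_mono fun p => ?_
          rw [← ENNReal.ofReal_mul (by positivity)]
          refine ENNReal.ofReal_le_ofReal ?_
          have := mul_le_mul_of_nonneg_left (hkey p) (hprof0 p)
          nlinarith [this]
      _ = ENNReal.ofReal (Real.exp 1 * CL) * ENNReal.ofReal X := by
          rw [lintegral_const_mul' _ _ ENNReal.ofReal_ne_top, hX,
            ofReal_integral_eq_lintegral_ofReal hIntP (ae_of_all _ fun p => mul_nonneg (hprof0 p) (mbDensity_nonneg _ ε p))]
  -- the hub integral in `ℝ≥0∞` form, bounded through the leader layer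
  set K : ℝ := Φ * (L : ℝ) ^ cΦ * (2 * Real.pi / b) ^ ((7 : ℝ) / 2) * (2 * Real.pi / ((1 - 1 / (2 * d)) * b)) ^ (d / 2) with hK
  have hc1 : 0 < 1 - 1 / (2 * d) := by rw [sub_pos, div_lt_one (by positivity)]; linarith
  have hK0 : 0 ≤ K := by positivity
  set T : ℝ := Real.exp (CT * (L : ℝ) ^ pT - b / (QT * (L : ℝ) ^ pT)) with hT
  have hIlint : ∫⁻ η : GnoCoord L, ENNReal.ofReal (Real.exp (-(b * gnoDeficit z₀ (fun _ => 1) (hubAt δt 1) ε η)) * gnoDensity η) ≤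
      ENNReal.ofReal (K * (Real.exp 1 * CL * X) + T) := by
    rw [lintegral_hub_eq_leaderLayer]
    refine hLLi.trans ?_
    calc ENNReal.ofReal K * (∫⁻ p : ℝ × ℝ, ENNReal.ofReal ((1 + δt ^ 2) ^ 2 / (1 + (p.1 ^ 2 / (1 + p.1 ^ 2) + p.2 ^ 2 / (1 + p.2 ^ 2)) * (1 + δt ^ 2)) *
            ((1 + p.1 ^ 2)⁻¹ * (1 + p.2 ^ 2)⁻¹ / Real.sqrt (LinearMap.det (A0 (gnoBase p.1 p.2)))))) + ENNReal.ofReal T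
        ≤ ENNReal.ofReal K * (ENNReal.ofReal (Real.exp 1 * CL) * ENNReal.ofReal X) + ENNReal.ofReal T :=
          add_le_add (mul_le_mul_of_nonneg_left hlin zero_le) le_rfl
      _ = ENNReal.ofReal (K * (Real.exp 1 * CL * X) + T) := by
          rw [ENNReal.ofReal_add (by positivity) (Real.exp_pos _).le, ENNReal.ofReal_mul (p := K) hK0,
            ENNReal.ofReal_mul (p := Real.exp 1 * CL) (by positivity)]
  have hI : hubIntegral (hubAt δt 1) ε b ≤ K * (Real.exp 1 * CL * X) + T := by
    have hc : Continuous fun η : GnoCoord L => gnoDeficit z₀ (fun _ => 1) (hubAt δt 1) ε η :=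
      (Gnomonic.contDiff_gnoDeficit (n := 0) (fun _ => false) (fun _ => (1 : SU2)) (hubAt_one_ne_zero δt) ε).continuous
    have hsm : AEStronglyMeasurable (fun η : GnoCoord L => Real.exp (-(b * gnoDeficit z₀ (fun _ => 1) (hubAt δt 1) ε η)) * gnoDensity η) volume := by
      have hc2 : Continuous fun η : GnoCoord L => Real.exp (-(b * gnoDeficit z₀ (fun _ => 1) (hubAt δt 1) ε η)) * gnoDensity η :=
        (Real.continuous_exp.comp (Continuous.neg (hc.const_mul b))).mul continuous_gnoDensity
      exact hc2.aestronglyMeasurable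
    unfold hubIntegral
    rw [integral_eq_lintegral_of_nonneg_ae (ae_of_all _ fun η => mul_nonneg (Real.exp_pos _).le (gnoDensity_pos η).le) hsm]
    exact ENNReal.toReal_le_of_le_ofReal (by positivity) hIlint
  -- constants: `(2π/b)^{7/2}·G_b ≤ (4/3)(2π/b)^α`, `C_L ≤ (19·20400)^{7/2}·L²⁸`
  have hGb : (2 * Real.pi / b) ^ ((7 : ℝ) / 2) * (2 * Real.pi / ((1 - 1 / (2 * d)) * b)) ^ (d / 2) ≤ 4 / 3 * (2 * Real.pi / b) ^ alpha L := by
    have h := followerGauss_le (d := d) (by linarith) hb0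
    calc (2 * Real.pi / b) ^ ((7 : ℝ) / 2) * (2 * Real.pi / ((1 - 1 / (2 * d)) * b)) ^ (d / 2)
        ≤ (2 * Real.pi / b) ^ ((7 : ℝ) / 2) * (4 / 3 * (2 * Real.pi / b) ^ (d / 2)) := mul_le_mul_of_nonneg_left h (by positivity)
      _ = 4 / 3 * ((2 * Real.pi / b) ^ ((7 : ℝ) / 2) * (2 * Real.pi / b) ^ (d / 2)) := by ring
      _ = 4 / 3 * (2 * Real.pi / b) ^ alpha L := by rw [← Real.rpow_add (by positivity), hd, seven_add_finrank_gnoFol]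
  have hCLle : CL ≤ (19 * 20400 : ℝ) ^ ((7 : ℝ) / 2) * (L : ℝ) ^ 28 := leaderCeilConst_le hL1 (by linarith) hd18
  calc hubIntegral (hubAt δt 1) ε b ≤ K * (Real.exp 1 * CL * X) + T := hI
    _ = Φ * (L : ℝ) ^ cΦ * ((2 * Real.pi / b) ^ ((7 : ℝ) / 2) * (2 * Real.pi / ((1 - 1 / (2 * d)) * b)) ^ (d / 2)) * (Real.exp 1 * CL) * X + T := by
        rw [hK]; ring
    _ ≤ Φ * (L : ℝ) ^ cΦ * (4 / 3 * (2 * Real.pi / b) ^ alpha L) * (Real.exp 1 * ((19 * 20400 : ℝ) ^ ((7 : ℝ) / 2) * (L : ℝ) ^ 28)) * X + T := by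
        gcongr
    _ = Φ * (4 / 3) * (Real.exp 1 * (19 * 20400 : ℝ) ^ ((7 : ℝ) / 2)) * (L : ℝ) ^ (cΦ + 28) * ((2 * Real.pi / b) ^ alpha L * X) + T := by
        rw [pow_add]; ring

end Summit.QuantumFields.YangMills.Theorems.SwapVirialDeficit.SectorLaplace

end
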